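import Summits.AtomisticToContinuum.FouriersLaw.Theses.PhononMeanFreePath

/-!
# BoundaryKubo (stmt-AtomisticToContinuum-11812) — crux-ideate round 1, ideator 2: first lemmas of three lines

Elaboration sketch only (statements; no proofs are claimed).  `P = pinnedChain ω₂ lam β γ`,
`K_t^{T_L,T_R} = P.transitionKernel n T_L T_R t` (constructed Langevin kernels), `μ_T = P.gibbsMeasure n T`.

* `LambdaInvertsL0` — first lemma of card `mclennan-defect-hotter-gibbs` (Kubo side of the exact
  O(δ) cancellation in the McLennan defect identity); `HotterGibbsSubinvariance` — its companion:
  for a reference temperature `T⋆ ≥ max(T_L,T_R)` the Gibbs measure `μ_{T⋆}` is sub-invariant for the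
  (non-equilibrium) kernels, `μ_{T⋆} K_t ≤ e^{2γt} μ_{T⋆}` (formal adjoint: `L^† e^{-H/T⋆} = w·e^{-H/T⋆}`,
  `w = Σ_b γ(1 - T_b/T⋆)(1 - p_b²/T⋆) ≤ 2γ`; rigorous via the reversal duality of
  `LangevinChainReversal` + the supermartingale `e^{-H(ẑ_t)/T⋆}` of the reversed dynamics).
* `TiltedFiniteTimeResponse` — first lemma of card `anti-friction-tilt`: under the stationary
  equilibrium process, `E[A(z_t) · 𝓜_t] = 4γ ∫₀ᵗ Cov_{μ_T}(p₀², K_u A) du`, where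
  `𝓜_t = p₀(z_t)² - p₀(z_0)² - ∫₀ᵗ (L p₀²)(z_s) ds` is the Dynkin martingale of the bath-site kinetic
  energy (= `4T² ×` the ε-derivative of the anti-friction Doob tilt `exp(ε p₀²/4T²)`).
* `WeightedGradientBound` — first lemma of card `costate-gramian-lipschitz-gap`: Hairer–Majda
  Assumption 4 (with `U₁ = 0`) for the equal-temperature kernels at time 1 with the energy weight
  `e^{θH}`: `‖D(K_1 φ)(x)‖² ≤ C e^{θH(x)} K_1(φ²)(x)`.
-/

namespace Summit.AtomisticToContinuum.FouriersLaw.Cruxes.BoundaryKubo.Ideator2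

open MeasureTheory
open scoped NNReal ContDiff
open Literature.MathematicalPhysics.KineticTheory.HeatConduction Literature.Probability.Process

/-- Card A, first lemma (load-bearing): `Λ` inverts `L₀` on the Gibbs-centred class —
`∫₀^∞ ∫ (p₀² - T) · K_t(L₀ f) dμ_T dt = - ∫ (p₀² - T) f dμ_T` for `f ∈ C_c^∞` (Gibbs invariance of the
constructed kernels + Dynkin + decay of equilibrium covariances). -/
def LambdaInvertsL0 : Prop :=
  ∀ ω₂ lam β γ : ℝ, 0 < ω₂ → 0 < lam → 0 < β → 0 < γ → ∀ T : ℝ, 0 < T → ∀ N : ℕ,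
    ∀ f : PhaseSpace (N + 1) → ℝ, ContDiff ℝ ∞ f → HasCompactSupport f →
      MeasureTheory.IntegrableOn
          (fun t : ℝ => ∫ z, ((z.2 0) ^ 2 - T) *
              (∫ y, (pinnedChain ω₂ lam β γ).generator (N + 1) T T f y
                ∂((pinnedChain ω₂ lam β γ).transitionKernel (N + 1) T T t.toNNReal z))
            ∂((pinnedChain ω₂ lam β γ).gibbsMeasure (N + 1) T))
          (Set.Ioi 0) ∧
        ∫ t in Set.Ioi (0 : ℝ), ∫ z, ((z.2 0) ^ 2 - T) *
            (∫ y, (pinnedChain ω₂ lam β γ).generator (N + 1) T T f y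
              ∂((pinnedChain ω₂ lam β γ).transitionKernel (N + 1) T T t.toNNReal z))
          ∂((pinnedChain ω₂ lam β γ).gibbsMeasure (N + 1) T)
        = - ∫ z, ((z.2 0) ^ 2 - T) * f z ∂((pinnedChain ω₂ lam β γ).gibbsMeasure (N + 1) T)

/-- Card A, first lemma: hotter-Gibbs sub-invariance `μ_{T⋆} K_t ≤ e^{2γt} μ_{T⋆}` for the
pinned chain at bath temperatures `T_L, T_R ≤ T⋆`. -/
def HotterGibbsSubinvariance : Prop :=
  ∀ ω₂ lam β γ : ℝ, 0 < ω₂ → 0 < lam → 0 < β → 0 < γ → ∀ (n : ℕ) (T_L T_R Tstar : ℝ),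
    0 < T_L → 0 < T_R → T_L ≤ Tstar → T_R ≤ Tstar → ∀ (t : ℝ≥0) (A : Set (PhaseSpace n)),
    MeasurableSet A →
      ∫⁻ z, ((pinnedChain ω₂ lam β γ).transitionKernel n T_L T_R t z) A
          ∂((pinnedChain ω₂ lam β γ).gibbsMeasure n Tstar)
        ≤ ENNReal.ofReal (Real.exp (2 * γ * (t : ℝ))) * (pinnedChain ω₂ lam β γ).gibbsMeasure n Tstar A

/-- Card B, first lemma: the finite-time thermo-mechanical (tilted) response identity under the
stationary equilibrium process `z_s = solMap (N+1) T T s x (pairPath w)`, `x ∼ μ_T`, `w ∼ wienerPair`,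
for the right-bath kinetic energy `A = p_N²` (chain of `N + 1 ≥ 2` sites). -/
def TiltedFiniteTimeResponse : Prop :=
  ∀ ω₂ lam β γ : ℝ, 0 < ω₂ → 0 < lam → 0 < β → 0 < γ → ∀ T : ℝ, 0 < T → ∀ N : ℕ, 0 < N →
    ∀ t : ℝ, 0 ≤ t →
      (∫ x, (∫ w,
          (((pinnedChain ω₂ lam β γ).solMap (N + 1) T T t x (pairPath w)).2 (Fin.last N)) ^ 2 *
            ((((pinnedChain ω₂ lam β γ).solMap (N + 1) T T t x (pairPath w)).2 0) ^ 2 - (x.2 0) ^ 2 -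
              ∫ s in (0 : ℝ)..t,
                (pinnedChain ω₂ lam β γ).generator (N + 1) T T (fun y => (y.2 0) ^ 2)
                  ((pinnedChain ω₂ lam β γ).solMap (N + 1) T T s x (pairPath w)))
          ∂wienerPair)
        ∂((pinnedChain ω₂ lam β γ).gibbsMeasure (N + 1) T))
      = 4 * γ * ∫ u in (0 : ℝ)..t,
          ((∫ x, (x.2 0) ^ 2 * (∫ y, (y.2 (Fin.last N)) ^ 2
                ∂((pinnedChain ω₂ lam β γ).transitionKernel (N + 1) T T u.toNNReal x))
              ∂((pinnedChain ω₂ lam β γ).gibbsMeasure (N + 1) T))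
            - (∫ x, (x.2 0) ^ 2 ∂((pinnedChain ω₂ lam β γ).gibbsMeasure (N + 1) T)) *
              (∫ x, (∫ y, (y.2 (Fin.last N)) ^ 2
                ∂((pinnedChain ω₂ lam β γ).transitionKernel (N + 1) T T u.toNNReal x))
                ∂((pinnedChain ω₂ lam β γ).gibbsMeasure (N + 1) T)))

/-- Card C, first lemma: Hairer–Majda's gradient bound (Assumption 4 with `U₁ = 0`,
`U₂² = C e^{θH}`) for the equal-temperature kernels at time `1`. -/
def WeightedGradientBound : Prop :=
  ∀ ω₂ lam β γ : ℝ, 0 < ω₂ → 0 < lam → 0 < β → 0 < γ → ∀ T : ℝ, 0 < T → ∀ n : ℕ,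
    ∃ C θ : ℝ, 0 < C ∧ 0 < θ ∧ θ * T < 1 ∧
      ∀ φ : PhaseSpace n → ℝ, ContDiff ℝ 1 φ → (∃ M : ℝ, ∀ y, |φ y| ≤ M) →
        (∃ M : ℝ, ∀ y, ‖fderiv ℝ φ y‖ ≤ M) → ∀ x : PhaseSpace n,
          ‖fderiv ℝ (fun z => ∫ y, φ y ∂((pinnedChain ω₂ lam β γ).transitionKernel n T T 1 z)) x‖ ^ 2
            ≤ C * Real.exp (θ * (pinnedChain ω₂ lam β γ).hamiltonian n x) *
              ∫ y, (φ y) ^ 2 ∂((pinnedChain ω₂ lam β γ).transitionKernel n T T 1 x)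

end Summit.AtomisticToContinuum.FouriersLaw.Cruxes.BoundaryKubo.Ideator2
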